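import Summits.ABC.ABC.Theorems.DefiniteXiFreyModularityStubNineTransferTorsion
import Literature.NumberTheory.Automorphic.CDTTheorem712ConductorStepProofs
import Literature.NumberTheory.EllipticCurves.InertiaInvariantsAdditiveProofs
import Literature.NumberTheory.EllipticCurves.TateModuleFixedPointsProofs
import Literature.NumberTheory.EllipticCurves.TateModuleContinuityProofs
import Literature.NumberTheory.DiophantineGeometry.ConductorAdditiveProofs
import Literature.NumberTheory.DiophantineGeometry.ConductorFactorizationProofs
import Literature.NumberTheory.DiophantineGeometry.ConductorRingOfIntegersProofs
import HarnessLib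

/-!
# Crux `FreyModularity` (stmt-ABC-11340), line `Sketch`: the stub `stub_nineTransfer`
# (Silverberg, CSS 1997, Prop. 7.1 at `3`) — proved

The registered stub `stub_nineTransfer` of the line `Sketch` of the crux
`Summit.ABC.ABC.Theses.DefiniteXi.FreyModularity`: **for elliptic curves `E, E'/ℚ` with a common
framed model `ρ̄` of `E[5]` and `E'[5]` (`IsTorsionGaloisRep`: `E[5] ≅ E'[5]` as `Γ_ℚ`-modules)
and `9 ∤ N_E`, also `9 ∤ N_{E'}`** — semistability at `3` is read off from `E[5]` (A. Silverberg,
in Cornell–Silverman–Stevens 1997, Prop. 7.1; Wiles 1995, Ch. 5, for the `3`–`5` switch).  It is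
the `9`-analogue of the tree's `27`-transfer `CDT_theorem_7_1_2_conductorStep`, but its content is
tame rather than wild, and the proof is by inertia invariants of the `5`-torsion at `3`:

* `sq_dvd_conductorNorm_iff_hasAdditiveReductionAt` — `p² ∣ N_E` iff `E` has additive reduction
  at `p` (`N_E = ∏ p^{f_p}`, `factorization_conductorNorm_holds`; `f_p ≥ 2` iff additive,
  `two_le_conductorExponent_iff_holds`);
* `exists_ne_zero_smul_eq_of_codimFixed_le_one` — if `codim (V_ℓ E)^{I_𝔓} ≤ 1` then `I_𝔓` fixes a
  non-zero `ℓ`-torsion point: otherwise `E(K̄)^{I_𝔓}` has no `ℓ`-power torsion at all and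
  `codim = 2` (`codimFixed_inertia_rationalTate_eq_two_of_finite`, `TateModuleFixedPointsProofs`);
* `exists_ne_zero_smul_eq_of_not_hasAdditiveReductionAt` — **at a place `v ∤ ℓ` of good or
  multiplicative reduction `E[ℓ]^{I_𝔓} ≠ 0`** (Silverman *ATAEC* Thm. IV.10.2(a): `codim = 0`,
  resp. `1`, the tree's `codimFixed_inertia_rationalTate_eq_zero_of_hasGoodReductionAt` and
  `codimFixed_inertia_rationalTate_eq_one_of_hasMultiplicativeReductionAt_holds`);
* `exists_torsion_of_isTorsionGaloisRep` — a common framed model transports `Γ`-fixed torsion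
  points from `E` to `E'`;
* `stub_nineTransfer` — if `9 ∣ N_{E'}` then `E'` is additive at `3`, so `E'[5]^{I_3} = 0` by the
  second support file (`stub_nineTransfer_torsion`: Kodaira–Néron, `c_3(E') ≤ 4 < 5`), whereas
  `E` is semistable at `3` (`9 ∤ N_E`), so `E[5]^{I_3} ≠ 0` — contradiction along `E[5] ≅ E'[5]`.

## References

* [SilverbergCSS1997] A. Silverberg, *Explicit families of elliptic curves with prescribed mod N
  representations*, in: G. Cornell, J. H. Silverman, G. Stevens (eds.), *Modular Forms and
  Fermat's Last Theorem*, Springer (1997), Prop. 7.1.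
* [SilvermanATAEC1994] J. H. Silverman, *Advanced Topics in the Arithmetic of Elliptic Curves*,
  GTM 151 (1994), Thm. IV.10.2(a) (PDF p. 358), Cor. IV.9.2(d).
* [SilvermanAEC2009] J. H. Silverman, *The Arithmetic of Elliptic Curves*, 2nd ed. (2009),
  Thm. VII.7.1 and its proof.
-/

-- `Summit.<Summit>.<Problem>` is the mandated summit-side namespace (CONVENTIONS §2); for the
-- single-conjunct summit `ABC` the two coincide, so the duplicate `ABC.ABC` is deliberate.
set_option linter.dupNamespace false

noncomputable section

open scoped MatrixGroups NumberField

open Matrix Field IsDedekindDomain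
open Literature.NumberTheory.EllipticCurves
open Literature.NumberTheory.Automorphic
open Literature.NumberTheory.Automorphic.BCDT
open Literature.NumberTheory.GaloisRepresentations
open Literature.NumberTheory.DiophantineGeometry
open WeierstrassCurve

namespace Summit.ABC.ABC.Theorems

/-! ## `p² ∣ N_E` iff additive reduction at `p` -/

/-- **`p² ∣ N_E` iff `E` has additive reduction at `p`**, for an elliptic curve `E/ℚ`, a prime
`p` and the place `v` of `𝓞 ℚ` above `p`: the exponent of `p` in `N_E = ∏ p^{f_p}` is the
conductor exponent (`factorization_conductorNorm_holds`, read over `𝓞 ℚ` by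
`conductorExponent_ringOfIntegers_eq`), and `f_v ≥ 2` iff the reduction is additive
(`two_le_conductorExponent_iff_holds`; Silverman *ATAEC* IV.10.2(a): `ε = 2` iff additive,
`f = ε + δ`). [cite: SilvermanATAEC1994, Thm. IV.10.2(a) (PDF p. 358)] -/
theorem sq_dvd_conductorNorm_iff_hasAdditiveReductionAt (W : WeierstrassCurve ℚ) [W.IsElliptic]
    {p : ℕ} (hp : p.Prime) {v : HeightOneSpectrum (𝓞 ℚ)}
    (hv : (Rat.HeightOneSpectrum.primesEquiv v : ℕ) = p) :
    p ^ 2 ∣ W.conductorNorm ℤ ↔ W.HasAdditiveReductionAt v := by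
  classical
  set pp : Nat.Primes := ⟨p, hp⟩ with hpp
  have hvp : Rat.HeightOneSpectrum.primesEquiv v = pp := Subtype.ext hv
  set vZ : HeightOneSpectrum ℤ := (Rat.HeightOneSpectrum.primesEquiv (R := ℤ)).symm pp with hvZ
  have hfac := factorization_conductorNorm_holds W vZ
  have hgen : Rat.HeightOneSpectrum.natGenerator vZ = p := by
    change ((Rat.HeightOneSpectrum.primesEquiv vZ : Nat.Primes) : ℕ) = p
    rw [hvZ, Equiv.apply_symm_apply]
  rw [hgen] at hfac
  have hf : W.conductorExponent v = W.conductorExponent vZ := by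
    rw [conductorExponent_ringOfIntegers_eq W v, hvp]
  rw [Nat.Prime.pow_dvd_iff_le_factorization hp (conductorNorm_pos_holds W).ne', hfac, ← hf,
    two_le_conductorExponent_iff_holds v W]

/-! ## Inertia invariants of the `ℓ`-torsion at a semistable place -/

section NumberField

variable {K : Type} [Field K] [NumberField K]

/-- **If `codim (V_ℓ E)^{I_𝔓} ≤ 1` then `I_𝔓` fixes a non-zero `ℓ`-torsion point of `E(K̄)`.**
Otherwise every `I_𝔓`-fixed point killed by `ℓ` is `O`, hence (induction on `n`, `ℓ · P` being
fixed with `P`) every `I_𝔓`-fixed point killed by some `ℓⁿ` is `O`: the `ℓ`-power torsion of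
`E(K̄)^{I_𝔓}` is finite and `codim (V_ℓ E)^{I_𝔓} = 2`
(`codimFixed_inertia_rationalTate_eq_two_of_finite`; Silverman *ATAEC*, proof of Thm. IV.10.2(a):
"`V_ℓ(A)` will be `0` … if `A` is a finite group").
[cite: SilvermanATAEC1994, proof of Thm. IV.10.2(a) (PDF p. 359)] -/
theorem exists_ne_zero_smul_eq_of_codimFixed_le_one (W : WeierstrassCurve K) [W.IsElliptic]
    (ℓ : ℕ) [Fact ℓ.Prime]
    (h : Continuous fun x : absoluteGaloisGroup K × RationalTateModule (geomPoints W) ℓ ↦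
      rationalTateRepresentation (absoluteGaloisGroup K) (geomPoints W) ℓ x.1 x.2)
    (𝔓 : Ideal (absIntegers (𝓞 K) K))
    (hcodim : (rationalTateGaloisRepOf (geomPoints W) ℓ h).codimFixed
      (𝔓.inertia (absoluteGaloisGroup K)) ≤ 1) :
    ∃ P : geomPoints W, P ≠ 0 ∧ ℓ • P = 0 ∧
      ∀ σ ∈ 𝔓.inertia (absoluteGaloisGroup K), σ • P = P := by
  by_contra hall
  push Not at hall
  -- every `I_𝔓`-fixed point killed by a power of `ℓ` is `O`
  have key : ∀ (n : ℕ) (P : FixedPoints.addSubgroup (𝔓.inertia (absoluteGaloisGroup K)) (geomPoints W)),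
      ℓ ^ n • P = 0 → P = 0 := by
    intro n
    induction n with
    | zero =>
      intro P hP
      rwa [pow_zero, one_smul] at hP
    | succ n ih =>
      intro P hP
      have h1 : ℓ ^ n • (ℓ • P) = 0 := by rwa [smul_smul, ← pow_succ]
      have h2 : ℓ • P = 0 := ih _ h1
      by_contra hP0
      have hP0' : (P : geomPoints W) ≠ 0 := fun h0 ↦ hP0 (Subtype.ext h0)
      have hℓP : ℓ • (P : geomPoints W) = 0 := by
        rw [← AddSubgroup.coe_nsmul, h2, AddSubgroup.coe_zero]
      obtain ⟨σ, hσ, hne⟩ := hall P hP0' hℓP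
      exact hne ((FixedPoints.mem_addSubgroup _ _ _).mp P.2 ⟨σ, hσ⟩)
  have hfin : {P : FixedPoints.addSubgroup (𝔓.inertia (absoluteGaloisGroup K)) (geomPoints W) |
      ∃ n : ℕ, ℓ ^ n • P = 0}.Finite := by
    refine (Set.finite_singleton
      (0 : FixedPoints.addSubgroup (𝔓.inertia (absoluteGaloisGroup K)) (geomPoints W))).subset ?_
    rintro P ⟨n, hn⟩
    exact key n P hn
  have h2 := W.codimFixed_inertia_rationalTate_eq_two_of_finite ℓ h 𝔓 hfin
  omega

/-- **At a place `v ∤ ℓ` which is not additive, `E[ℓ]^{I_𝔓} ≠ 0` for every `𝔓 ∣ v`**: for an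
elliptic curve `E/K` over a number field with good or multiplicative reduction at `v ∤ ℓ`,
`codim (V_ℓ E)^{I_𝔓}` is `0`, resp. `1` (Silverman *ATAEC* Thm. IV.10.2(a); the tree's
`codimFixed_inertia_rationalTate_eq_zero_of_hasGoodReductionAt`,
`codimFixed_inertia_rationalTate_eq_one_of_hasMultiplicativeReductionAt_holds`, continuity by
`continuous_rationalGaloisRepTate_holds`), so `I_𝔓` fixes a non-zero `ℓ`-torsion point
(`exists_ne_zero_smul_eq_of_codimFixed_le_one`).  (Good reduction: `E[ℓ]` is unramified,
Néron–Ogg–Shafarevich; multiplicative: the Tate curve, `μ_ℓ ⊂ E[ℓ]`.)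
[cite: SilvermanATAEC1994, Thm. IV.10.2(a) (PDF pp. 358–360)] -/
theorem exists_ne_zero_smul_eq_of_not_hasAdditiveReductionAt (W : WeierstrassCurve K)
    [W.IsElliptic] (ℓ : ℕ) [Fact ℓ.Prime] {v : HeightOneSpectrum (𝓞 K)}
    (hℓ : (ℓ : 𝓞 K) ∉ v.asIdeal) (hv : ¬ W.HasAdditiveReductionAt v)
    {𝔓 : Ideal (absIntegers (𝓞 K) K)} (h𝔓 : 𝔓 ∈ v.primesAbove) :
    ∃ P : geomPoints W, P ≠ 0 ∧ ℓ • P = 0 ∧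
      ∀ σ ∈ 𝔓.inertia (absoluteGaloisGroup K), σ • P = P := by
  have h := W.continuous_rationalGaloisRepTate_holds ℓ
  refine exists_ne_zero_smul_eq_of_codimFixed_le_one W ℓ h 𝔓 ?_
  rcases W.hasGoodReductionAt_or_hasMultiplicativeReductionAt_or_hasAdditiveReductionAt v with
    hg | hm | ha
  · rw [W.codimFixed_inertia_rationalTate_eq_zero_of_hasGoodReductionAt ℓ h hg hℓ h𝔓]
    exact zero_le_one
  · exact (W.codimFixed_inertia_rationalTate_eq_one_of_hasMultiplicativeReductionAt_holds ℓ h v hℓ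
      hm h𝔓).le
  · exact absurd ha hv

end NumberField

/-! ## Transport of fixed torsion points along a common framed model -/

/-- **A common framed model of `E[n]` and `E'[n]` transports `Γ`-fixed points.**  If `ρ̄` is a
framed model of both `E[n]` and `E'[n]` (frames `e : E[n] ≃ (ℤ/n)²`, `e' : E'[n] ≃ (ℤ/n)²` with
`e(σP) = ρ̄(σ) e(P)`, `e'(σP') = ρ̄(σ) e'(P')`), then `P' = e'⁻¹(e(P))` is zero iff `P` is and is
fixed by every `σ` fixing `P` (`e'(σP') = ρ̄(σ) e(P) = e(σP) = e(P) = e'(P')`). [folklore] -/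
theorem exists_torsion_of_isTorsionGaloisRep {F : Type*} [Field F] {W W' : WeierstrassCurve F}
    {n : ℕ} {ρ : FramedGaloisRep F (ZMod n) 2} (hρ : W.IsTorsionGaloisRep n ρ)
    (hρ' : W'.IsTorsionGaloisRep n ρ) (P : geomTorsion W n) :
    ∃ P' : geomTorsion W' n, (P' = 0 ↔ P = 0) ∧
      ∀ σ : absoluteGaloisGroup F, σ • P = P → σ • P' = P' := by
  obtain ⟨e, he⟩ := hρ
  obtain ⟨e', he'⟩ := hρ'
  refine ⟨e'.symm (e P), ?_, fun σ hσ ↦ ?_⟩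
  · rw [map_eq_zero_iff _ e'.symm.injective, map_eq_zero_iff _ e.injective]
  · apply e'.injective
    rw [he', AddEquiv.apply_symm_apply, ← he, hσ]

/-! ## The stub -/

/-- **Stub S6 — semistability at `3` transfers along `E'[5] ≅ E[5]`** (Silverberg, CSS 1997,
Prop. 7.1; Wiles 1995, Ch. 5): if `E, E'/ℚ` are elliptic curves with a common framed model `ρ̄` of
`E[5]` and `E'[5]` and `9 ∤ N_E`, then `9 ∤ N_{E'}`.  Proof: let `v` be the place of `𝓞 ℚ` above
`3` and `𝔓 ∣ v` a prime of `\bar ℤ`.  As `9 ∤ N_E`, `E` is not additive at `v`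
(`sq_dvd_conductorNorm_iff_hasAdditiveReductionAt`), so `I_𝔓` fixes a non-zero `P ∈ E[5]`
(`exists_ne_zero_smul_eq_of_not_hasAdditiveReductionAt`, `v ∤ 5`); along `ρ̄` it fixes a non-zero
`P' ∈ E'[5]` (`exists_torsion_of_isTorsionGaloisRep`).  If `9 ∣ N_{E'}`, then `E'` is additive at
`v`, and `P' = O` by `stub_nineTransfer_torsion` (`ℓ = 5 > 4 ≥ c_v(E')`) — a contradiction.
[cite: SilverbergCSS1997, Prop. 7.1] -/
theorem stub_nineTransfer :
    ∀ (W W' : WeierstrassCurve ℚ) [W.IsElliptic] [W'.IsElliptic] (ρ : ModPGaloisRep ℚ (ZMod 5) 2),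
      W.IsTorsionGaloisRep 5 ρ → W'.IsTorsionGaloisRep 5 ρ →
      ¬ 9 ∣ W.conductorNorm ℤ → ¬ 9 ∣ W'.conductorNorm ℤ := by
  intro W W' _ _ ρ hρ hρ' h9 h9'
  classical
  -- the place `v` of `𝓞 ℚ` above `3`, not above `5`, and a prime `𝔓 ∣ v` of `\bar ℤ`
  set v : HeightOneSpectrum (𝓞 ℚ) :=
    (Rat.HeightOneSpectrum.primesEquiv (R := 𝓞 ℚ)).symm ⟨3, Nat.prime_three⟩ with hv
  have hv3 : (Rat.HeightOneSpectrum.primesEquiv v : ℕ) = 3 := by rw [hv, Equiv.apply_symm_apply]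
  have h5v : ((5 : ℕ) : 𝓞 ℚ) ∉ v.asIdeal := by
    rw [natCast_mem_asIdeal_iff_eq_primesEquiv_symm v Nat.prime_five, hv,
      (Rat.HeightOneSpectrum.primesEquiv (R := 𝓞 ℚ)).symm.injective.eq_iff]
    intro h
    have := congrArg Subtype.val h
    norm_num at this
  obtain ⟨𝔓, h𝔓⟩ := HeightOneSpectrum.primesAbove_nonempty v
  -- `E` is not additive at `3`, `E'` is
  have hW : ¬ W.HasAdditiveReductionAt v := by
    rw [← sq_dvd_conductorNorm_iff_hasAdditiveReductionAt W Nat.prime_three hv3]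
    exact h9
  have hW' : W'.HasAdditiveReductionAt v := by
    rw [← sq_dvd_conductorNorm_iff_hasAdditiveReductionAt W' Nat.prime_three hv3]
    exact h9'
  -- a non-zero `5`-torsion point of `E` fixed by `I_𝔓`, transported to `E'`
  haveI : Fact (Nat.Prime 5) := ⟨Nat.prime_five⟩
  obtain ⟨P₀, hP₀0, hP₀5, hP₀fix⟩ :=
    exists_ne_zero_smul_eq_of_not_hasAdditiveReductionAt W 5 h5v hW h𝔓
  set P : geomTorsion W ((5 : ℕ) : ℤ) := ⟨P₀, AddSubgroup.torsionBy.nsmul_iff.mpr hP₀5⟩ with hPdef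
  obtain ⟨P', hP'0, hP'fix⟩ := exists_torsion_of_isTorsionGaloisRep hρ hρ' P
  have hPfix : ∀ σ ∈ 𝔓.inertia (absoluteGaloisGroup ℚ), σ • P = P := fun σ hσ ↦
    Subtype.ext (by rw [AddSubgroup.torsionBy.coe_smul]; exact hP₀fix σ hσ)
  -- `P' = O` by the vanishing of `E'[5]^{I_𝔓}` at the additive place `3`
  have hP'5 : 5 • (P' : geomPoints W') = 0 := AddSubgroup.torsionBy.nsmul_iff.mp P'.2
  have hP'zero : (P' : geomPoints W') = 0 :=
    stub_nineTransfer_torsion W' Nat.prime_five (by norm_num) h5v hW' h𝔓 (P' : geomPoints W') hP'5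
      (fun σ hσ ↦ by rw [← AddSubgroup.torsionBy.coe_smul, hP'fix σ (hPfix σ hσ)])
  have hP'eq : P' = 0 := Subtype.ext hP'zero
  have hPeq : P = 0 := hP'0.mp hP'eq
  exact hP₀0 (congrArg Subtype.val hPeq)

end Summit.ABC.ABC.Theorems

end
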